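import Summits.RiemannHypothesis.RiemannHypothesis.Theorems.IntegerScrewCensusDualWalkSound

/-!
# Route `IntegerScrew` — kernel checker for the census DUAL certificates (4): the packed integer layer

Exact semantics of the Kronecker-packed cell sums of `IntegerScrewCensusDualCheck/Walk`: virtual digit functions
(`packF L f = Σ_{k<L} f k · 2^{SW·k}`, slot extraction below the slot bound, the balanced signed version `slotZ`), the Taylor
weights `wAt cs φ k = ⌊φ^k c_k / 2^{s_k}⌋` with `wPack cs φ = Σ_k wAt_k 2^{SW k}`, the sparse rows `lowRowD` against the cell's
node integers (`innerSums (lowRowD …) xys = denseSums …`), and the node accumulation `accNodes`: the integers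
`RE = txx + tyy + nx` and `IM = tyx − txy + ny` are `Σ_k d_k 2^{SW k}` with the SIGNED virtual digits
`d^RE_k = Σ_{a>b} 2 Z_ab W_{ab,k} (x_a x_b + y_a y_b) + Σ_a A_a 2^52 W_{a,k} x_a`,
`d^IM_k = Σ_{a>b} 2 Z_ab W_{ab,k} (y_a x_b − x_a y_b) + Σ_a A_a 2^52 W_{a,k} y_a`.  Pure arithmetic; RH-free; nothing here
bears on the truth of RH.
-/

set_option linter.dupNamespace false
set_option autoImplicit false

namespace Summit.RiemannHypothesis.RiemannHypothesis.Theorems.IntegerScrew.Manifest.Fast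

open Finset
open Literature.Analysis.ValidatedNumerics.KroneckerDot

/-! ### Virtual digits (natural) -/

/-- A packed number with virtual digits `f`: `Σ_{k<L} f k · 2^{SW·k}`. -/
def packF (L : ℕ) (f : ℕ → ℕ) : ℕ := ∑ k ∈ range L, f k * SWB ^ k

/-- `packN` is `packF` of the list entries. -/
theorem packN_eq_packF (ds : List ℕ) : packN SWB ds = packF ds.length (fun k => ds.getD k 0) := packN_eq_sum SWB ds

set_option exponentiation.threshold 500 in
/-- `SWB = 2^SW`. -/
theorem SWB_eq : SWB = 2 ^ SW := rfl

/-- **Slot extraction**: below the slot bound, `slotAt (packF L f) k = f k` (`k < L`). -/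
theorem slotAt_packF {L : ℕ} {f : ℕ → ℕ} (hf : ∀ k, k < L → f k < SWB) {k : ℕ} (hk : k < L) : slotAt (packF L f) k = f k := by
  have hW : 0 < SWB := by rw [SWB_eq]; positivity
  let d : ℕ → ℕ := fun e => if e < L then f e else 0
  have hd : ∀ e, d e < SWB := fun e => by
    simp only [d]; split_ifs with h
    · exact hf e h
    · exact hW
  have hpk : packF L f = ∑ e ∈ range L, d e * SWB ^ e :=
    Finset.sum_congr rfl fun e he => by simp only [d, if_pos (Finset.mem_range.1 he)]
  show (packF L f) >>> (SW * k) &&& (SWB - 1) = f k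
  rw [Nat.shiftRight_eq_div_pow, SWB_eq, Nat.and_two_pow_sub_one_eq_mod, pow_mul, ← SWB_eq, hpk,
    sum_div_pow_mod hW d hd hk]
  simp only [d, if_pos hk]

/-! ### Virtual digits (signed) -/

/-- A packed INTEGER with signed virtual digits `f`: `Σ_{k<L} f k · 2^{SW·k}`. -/
def packFZ (L : ℕ) (f : ℕ → ℤ) : ℤ := ∑ k ∈ range L, f k * (SWB : ℤ) ^ k

/-- `packFZ` is additive. -/
theorem packFZ_add (L : ℕ) (f g : ℕ → ℤ) : packFZ L f + packFZ L g = packFZ L (fun k => f k + g k) := by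
  unfold packFZ; rw [← Finset.sum_add_distrib]; exact Finset.sum_congr rfl fun k _ => by ring

/-- `packFZ` is subtractive. -/
theorem packFZ_sub (L : ℕ) (f g : ℕ → ℤ) : packFZ L f - packFZ L g = packFZ L (fun k => f k - g k) := by
  unfold packFZ; rw [← Finset.sum_sub_distrib]; exact Finset.sum_congr rfl fun k _ => by ring

/-- `packFZ` is homogeneous. -/
theorem packFZ_smul (L : ℕ) (c : ℤ) (f : ℕ → ℤ) : c * packFZ L f = packFZ L (fun k => c * f k) := by
  unfold packFZ; rw [Finset.mul_sum]; exact Finset.sum_congr rfl fun k _ => by ring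

/-- `packFZ` of zero digits. -/
theorem packFZ_zero (L : ℕ) : packFZ L (fun _ => 0) = 0 := by simp [packFZ]

/-- `packFZ` depends only on the digits below `L`. -/
theorem packFZ_congr {L : ℕ} {f g : ℕ → ℤ} (h : ∀ k, k < L → f k = g k) : packFZ L f = packFZ L g :=
  Finset.sum_congr rfl fun k hk => by rw [h k (Finset.mem_range.1 hk)]

/-- A natural pack is a signed pack. -/
theorem packF_cast (L : ℕ) (f : ℕ → ℕ) : ((packF L f : ℕ) : ℤ) = packFZ L (fun k => (f k : ℤ)) := by
  unfold packF packFZ; push_cast; rfl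

/-- The balanced offset is the pack of `2^{SW−1}`'s. -/
theorem halfPack_eq (D : ℕ) : ((halfPack D : ℕ) : ℤ) = packFZ (D + 1) (fun _ => ((2 ^ (SW - 1) : ℕ) : ℤ)) := by
  unfold halfPack
  rw [packN_eq_packF, List.length_map, List.length_range, packF_cast]
  refine packFZ_congr fun k hk => ?_
  rw [List.getD_eq_getElem _ _ (by simpa using hk)]
  simp

set_option exponentiation.threshold 500 in
/-- **Signed slot extraction**: if `|f k| < 2^{SW−1}` for all `k ≤ D`, then `slotZ (halfPack D) (packFZ (D+1) f) k = f k`. -/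
theorem slotZ_packFZ {D : ℕ} {f : ℕ → ℤ} (hf : ∀ k, k < D + 1 → |f k| < 2 ^ (SW - 1)) {k : ℕ} (hk : k < D + 1) :
    slotZ (halfPack D) (packFZ (D + 1) f) k = f k := by
  unfold slotZ
  -- the shifted digits are naturals below the slot bound
  have hnn : ∀ j, j < D + 1 → 0 ≤ f j + 2 ^ (SW - 1) := fun j hj => by
    have := (abs_lt.1 (hf j hj)).1; linarith
  let g : ℕ → ℕ := fun j => (f j + 2 ^ (SW - 1)).toNat
  have hg : ∀ j, j < D + 1 → (g j : ℤ) = f j + 2 ^ (SW - 1) := fun j hj => Int.toNat_of_nonneg (hnn j hj)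
  have hglt : ∀ j, j < D + 1 → g j < SWB := fun j hj => by
    have h1 : (g j : ℤ) < SWB := by
      rw [hg j hj, SWB_eq]
      have := (abs_lt.1 (hf j hj)).2
      have e : ((2 ^ SW : ℕ) : ℤ) = 2 * 2 ^ (SW - 1) := by
        rw [show SW = (SW - 1) + 1 from rfl]; push_cast; ring
      rw [e]; linarith
    exact_mod_cast h1
  have hsum : packFZ (D + 1) f + (halfPack D : ℕ) = ((packF (D + 1) g : ℕ) : ℤ) := by
    rw [halfPack_eq, packFZ_add, packF_cast]
    refine packFZ_congr fun j hj => ?_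
    rw [hg j hj]; push_cast; ring
  have htoNat : (packFZ (D + 1) f + (halfPack D : ℕ)).toNat = packF (D + 1) g := by
    rw [hsum, Int.toNat_natCast]
  rw [htoNat, slotAt_packF hglt hk, hg k hk]
  push_cast
  ring

/-! ### The Taylor weights and the weight packs -/

/-- The Taylor weight `W_k(φ) = ⌊φ^k c_k / 2^{s_k}⌋` along the constant list `cs`. -/
def wAt (cs : List (ℕ × ℕ)) (φ k : ℕ) : ℕ := (φ ^ k * (cs.getD k (0, 0)).1) >>> (cs.getD k (0, 0)).2

/-- Length of `wDigits`. -/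
theorem length_wDigits (φ : ℕ) : ∀ (cs : List (ℕ × ℕ)) (pw : ℕ), (wDigits φ cs pw).length = cs.length
  | [], _ => rfl
  | (c, s) :: rest, pw => by simp only [wDigits, List.length_cons, length_wDigits φ rest]

/-- Entries of `wDigits` (running power `pw`). -/
theorem getD_wDigits (φ : ℕ) : ∀ (cs : List (ℕ × ℕ)) (pw i : ℕ), i < cs.length →
    (wDigits φ cs pw).getD i 0 = (pw * φ ^ i * (cs.getD i (0, 0)).1) >>> (cs.getD i (0, 0)).2
  | [], _, i, h => by simp at h
  | (c, s) :: rest, pw, 0, _ => by simp [wDigits]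
  | (c, s) :: rest, pw, i + 1, h => by
    simp only [wDigits, List.getD_cons_succ]
    rw [getD_wDigits φ rest (Nat.mul pw φ) i (by simpa using h), Nat.mul_eq, pow_succ]
    ring_nf

/-- **The weight pack is the pack of the weights**: `wPack cs φ = packF |cs| (wAt cs φ)`. -/
theorem wPack_eq (cs : List (ℕ × ℕ)) (φ : ℕ) : wPack cs φ = packF cs.length (wAt cs φ) := by
  unfold wPack
  rw [packN_eq_packF, length_wDigits]
  refine Finset.sum_congr rfl fun k hk => ?_
  dsimp only
  rw [getD_wDigits φ cs 1 k (Finset.mem_range.1 hk), one_mul]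
  rfl

/-- The weight pack as a signed pack. -/
theorem wPack_castZ (cs : List (ℕ × ℕ)) (φ : ℕ) : ((wPack cs φ : ℕ) : ℤ) = packFZ cs.length (fun k => (wAt cs φ k : ℤ)) := by
  rw [wPack_eq, packF_cast]

/-! ### The sparse rows against the node integers -/

/-- Dense semantics of a sparse row: walk the `Z` row prefix, the node `φ`'s and the node integers together. -/
def denseSums (cs : List (ℕ × ℕ)) (φa : ℕ) : List ℤ → List ℕ → List (ℤ × ℤ) → ℤ × ℤ
  | z :: zs, φb :: φs, xy :: rest =>
    let r := denseSums cs φa zs φs rest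
    if z = 0 then r else (r.1 + 2 * z * (wPack cs (φa - φb) : ℕ) * xy.1, r.2 + 2 * z * (wPack cs (φa - φb) : ℕ) * xy.2)
  | _, _, _ => (0, 0)

/-- `denseSums` against the empty list is `0`. -/
theorem denseSums_nil_right (cs : List (ℕ × ℕ)) (φa : ℕ) : ∀ (zs : List ℤ) (φs : List ℕ), denseSums cs φa zs φs [] = (0, 0)
  | [], _ => rfl
  | _ :: _, [] => rfl
  | _ :: _, _ :: _ => rfl

/-- **`innerSums` of a sparse row is the dense sum** (the gap bookkeeping of `lowRowD`). -/
theorem innerSums_lowRowD (cs : List (ℕ × ℕ)) (φa : ℕ) : ∀ (zs : List ℤ) (φs : List ℕ) (gap : ℕ) (xys : List (ℤ × ℤ)),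
    innerSums (lowRowD cs φa zs φs gap) xys = denseSums cs φa zs φs (xys.drop gap)
  | [], φs, gap, xys => by cases φs <;> simp [lowRowD, innerSums, denseSums]
  | z :: zs, [], gap, xys => by simp [lowRowD, innerSums, denseSums]
  | z :: zs, φb :: φs, gap, xys => by
    by_cases hz : z = 0
    · rw [show lowRowD cs φa (z :: zs) (φb :: φs) gap = lowRowD cs φa zs φs (gap + 1) by simp [lowRowD, hz],
        innerSums_lowRowD cs φa zs φs (gap + 1) xys]
      cases hd : xys.drop gap with
      | nil =>
        have : xys.drop (gap + 1) = [] := by rw [← List.drop_drop, hd]; rfl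
        rw [this, denseSums_nil_right]; simp [denseSums]
      | cons xy rest =>
        have : xys.drop (gap + 1) = rest := by rw [← List.drop_drop, hd]; rfl
        rw [this]; simp [denseSums, hz]
    · rw [show lowRowD cs φa (z :: zs) (φb :: φs) gap =
          (gap, 2 * z * (wPack cs (φa - φb) : ℕ)) :: lowRowD cs φa zs φs 0 by simp [lowRowD, hz]]
      simp only [innerSums]
      cases hd : xys.drop gap with
      | nil => simp [denseSums]
      | cons xy rest =>
        obtain ⟨x, y⟩ := xy
        simp only
        rw [innerSums_lowRowD cs φa zs φs 0 rest, List.drop_zero]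
        simp [denseSums, hz]

/-- The dense sums as signed packs: virtual digits `Σ_{i} [z_i ≠ 0]·2 z_i W_k(φa − φ_i)·x_i` (resp. `y_i`). -/
theorem denseSums_eq (cs : List (ℕ × ℕ)) (φa : ℕ) : ∀ (zs : List ℤ) (φs : List ℕ) (xys : List (ℤ × ℤ)),
    zs.length ≤ φs.length → zs.length ≤ xys.length →
    denseSums cs φa zs φs xys =
      (packFZ cs.length fun k => ∑ i ∈ range zs.length,
          2 * zs.getD i 0 * (wAt cs (φa - φs.getD i 0) k : ℕ) * (xys.getD i (0, 0)).1,
       packFZ cs.length fun k => ∑ i ∈ range zs.length,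
          2 * zs.getD i 0 * (wAt cs (φa - φs.getD i 0) k : ℕ) * (xys.getD i (0, 0)).2)
  | [], φs, xys, _, _ => by
    cases φs <;> cases xys <;> simp [denseSums, packFZ]
  | z :: zs, [], xys, h, _ => by simp at h
  | z :: zs, φb :: φs, [], _, h => by simp at h
  | z :: zs, φb :: φs, xy :: rest, h1, h2 => by
    have ih := denseSums_eq cs φa zs φs rest (by simpa using h1) (by simpa using h2)
    simp only [denseSums, ih, List.length_cons]
    have key : ∀ (proj : ℤ × ℤ → ℤ),
        (packFZ cs.length fun k => ∑ i ∈ range zs.length,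
            2 * zs.getD i 0 * (wAt cs (φa - φs.getD i 0) k : ℕ) * proj (rest.getD i (0, 0))) +
          2 * z * (wPack cs (φa - φb) : ℕ) * proj xy =
        packFZ cs.length fun k => ∑ i ∈ range (zs.length + 1),
            2 * (z :: zs).getD i 0 * (wAt cs (φa - (φb :: φs).getD i 0) k : ℕ) * proj ((xy :: rest).getD i (0, 0)) := by
      intro proj
      rw [wPack_castZ, show 2 * z * packFZ cs.length (fun k => (wAt cs (φa - φb) k : ℤ)) * proj xy =
        (2 * z * proj xy) * packFZ cs.length (fun k => (wAt cs (φa - φb) k : ℤ)) by ring, packFZ_smul, packFZ_add]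
      refine packFZ_congr fun k _ => ?_
      rw [Finset.sum_range_succ']
      simp only [List.getD_cons_succ, List.getD_cons_zero]
      ring
    split_ifs with hz
    · subst hz
      refine Prod.ext (packFZ_congr fun k _ => ?_) (packFZ_congr fun k _ => ?_) <;>
      · rw [Finset.sum_range_succ']; simp
    · exact Prod.ext (key Prod.fst) (key Prod.snd)

/-! ### The node accumulation -/

/-- Row `a` of the node data. -/
theorem nodeData_getD (cs : List (ℕ × ℕ)) (Z : List (List ℤ)) (φs : List ℕ) {a : ℕ} (ha : a < Z.length) (d : NodeD) :
    (nodeData cs Z φs).getD a d =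
      ⟨lowRowD cs (φs.getD a 0) ((Z.getD a []).take a) φs 0,
        -2 * sumZ (Z.getD a []) * (SCL * wPack cs (φs.getD a 0) : ℕ)⟩ := by
  unfold nodeData
  rw [List.getD_eq_getElem _ _ (by simpa using ha)]
  simp

/-- Length of the node data. -/
theorem length_nodeData (cs : List (ℕ × ℕ)) (Z : List (List ℤ)) (φs : List ℕ) : (nodeData cs Z φs).length = Z.length := by
  simp [nodeData]

/-- The pair digit weight `w_{ab,k} = 2 Z_ab · W_k(φ_a − φ_b)` (zero where `Z_ab = 0`). -/
def pairW (cs : List (ℕ × ℕ)) (Z : List (List ℤ)) (φs : List ℕ) (a b k : ℕ) : ℤ :=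
  2 * (Z.getD a []).getD b 0 * (wAt cs (φs.getD a 0 - φs.getD b 0) k : ℕ)

/-- The node digit weight `w_{a,k} = A_a · 2^52 · W_k(φ_a)`, `A_a = −2·rowsum_a`. -/
def nodeW (cs : List (ℕ × ℕ)) (Z : List (List ℤ)) (φs : List ℕ) (a k : ℕ) : ℤ :=
  -2 * sumZ (Z.getD a []) * ((SCL : ℕ) : ℤ) * (wAt cs (φs.getD a 0) k : ℕ)

/-- `accNodes` on cons/cons. -/
theorem accNodes_cons (xys0 : List (ℤ × ℤ)) (nd : NodeD) (nds : List NodeD) (x y : ℤ) (rest : List (ℤ × ℤ)) :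
    accNodes xys0 (nd :: nds) ((x, y) :: rest) =
      ⟨(accNodes xys0 nds rest).txx + x * (innerSums nd.low xys0).1, (accNodes xys0 nds rest).tyy + y * (innerSums nd.low xys0).2,
        (accNodes xys0 nds rest).tyx + y * (innerSums nd.low xys0).1, (accNodes xys0 nds rest).txy + x * (innerSums nd.low xys0).2,
        (accNodes xys0 nds rest).nx + nd.nom * x, (accNodes xys0 nds rest).ny + nd.nom * y⟩ := rfl

/-- `accNodes` with no node data is zero. -/
theorem accNodes_nil (xys0 : List (ℤ × ℤ)) (xys : List (ℤ × ℤ)) : accNodes xys0 [] xys = ⟨0, 0, 0, 0, 0, 0⟩ := by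
  cases xys <;> rfl

/-- The six digit functions of the accumulators from node `a0` on: pair sums over `a0 ≤ a < n`, `b < a`, node sums over
`a0 ≤ a < n` (`xs a = (xys0 a).1`, `ys a = (xys0 a).2`). -/
def accDigits (cs : List (ℕ × ℕ)) (Z : List (List ℤ)) (φs : List ℕ) (xys0 : List (ℤ × ℤ)) (a0 : ℕ) :
    (ℕ → ℤ) × (ℕ → ℤ) × (ℕ → ℤ) × (ℕ → ℤ) × (ℕ → ℤ) × (ℕ → ℤ) :=
  (fun k => ∑ a ∈ Ico a0 Z.length, ∑ b ∈ range a, (xys0.getD a (0, 0)).1 * (pairW cs Z φs a b k * (xys0.getD b (0, 0)).1),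
   fun k => ∑ a ∈ Ico a0 Z.length, ∑ b ∈ range a, (xys0.getD a (0, 0)).2 * (pairW cs Z φs a b k * (xys0.getD b (0, 0)).2),
   fun k => ∑ a ∈ Ico a0 Z.length, ∑ b ∈ range a, (xys0.getD a (0, 0)).2 * (pairW cs Z φs a b k * (xys0.getD b (0, 0)).1),
   fun k => ∑ a ∈ Ico a0 Z.length, ∑ b ∈ range a, (xys0.getD a (0, 0)).1 * (pairW cs Z φs a b k * (xys0.getD b (0, 0)).2),
   fun k => ∑ a ∈ Ico a0 Z.length, nodeW cs Z φs a k * (xys0.getD a (0, 0)).1,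
   fun k => ∑ a ∈ Ico a0 Z.length, nodeW cs Z φs a k * (xys0.getD a (0, 0)).2)

/-- The inner sums of node `a`'s row are the signed packs of `Σ_{b<a} w_{ab} x_b` and `Σ_{b<a} w_{ab} y_b`. -/
theorem innerSums_node (cs : List (ℕ × ℕ)) (Z : List (List ℤ)) (φs : List ℕ) (xys0 : List (ℤ × ℤ))
    (hsq : ∀ row ∈ Z, row.length = Z.length) (hφ : Z.length ≤ φs.length) (hx : Z.length ≤ xys0.length) {a : ℕ}
    (ha : a < Z.length) :
    innerSums (lowRowD cs (φs.getD a 0) ((Z.getD a []).take a) φs 0) xys0 =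
      (packFZ cs.length fun k => ∑ b ∈ range a, pairW cs Z φs a b k * (xys0.getD b (0, 0)).1,
       packFZ cs.length fun k => ∑ b ∈ range a, pairW cs Z φs a b k * (xys0.getD b (0, 0)).2) := by
  have hrow : (Z.getD a []).length = Z.length := by
    rw [List.getD_eq_getElem _ _ ha]; exact hsq _ (List.getElem_mem ha)
  have hlen : ((Z.getD a []).take a).length = a := by rw [List.length_take, hrow]; omega
  rw [innerSums_lowRowD, List.drop_zero, denseSums_eq cs _ _ _ _ (by rw [hlen]; omega) (by rw [hlen]; omega), hlen]
  have hget : ∀ b, b < a → ((Z.getD a []).take a).getD b 0 = (Z.getD a []).getD b 0 := fun b hb => by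
    rw [List.getD_eq_getElem?_getD, List.getElem?_take_of_lt hb, ← List.getD_eq_getElem?_getD]
  refine Prod.ext (packFZ_congr fun k _ => Finset.sum_congr rfl fun b hb => ?_)
    (packFZ_congr fun k _ => Finset.sum_congr rfl fun b hb => ?_) <;>
  · rw [Finset.mem_range] at hb; rw [hget b hb]; unfold pairW; ring

/-- **The accumulators are signed packs of explicit sums** (from node `a0` on; `a0 = 0` is the full cell). -/
theorem accNodes_eq (cs : List (ℕ × ℕ)) (Z : List (List ℤ)) (φs : List ℕ) (xys0 : List (ℤ × ℤ))
    (hsq : ∀ row ∈ Z, row.length = Z.length) (hφ : Z.length ≤ φs.length) (hx : Z.length ≤ xys0.length) :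
    ∀ (t a0 : ℕ), a0 + t = Z.length →
      accNodes xys0 ((nodeData cs Z φs).drop a0) (xys0.drop a0) =
        ⟨packFZ cs.length (accDigits cs Z φs xys0 a0).1, packFZ cs.length (accDigits cs Z φs xys0 a0).2.1,
          packFZ cs.length (accDigits cs Z φs xys0 a0).2.2.1, packFZ cs.length (accDigits cs Z φs xys0 a0).2.2.2.1,
          packFZ cs.length (accDigits cs Z φs xys0 a0).2.2.2.2.1, packFZ cs.length (accDigits cs Z φs xys0 a0).2.2.2.2.2⟩ := by
  intro t
  induction t with
  | zero =>
    intro a0 h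
    rw [Nat.add_zero] at h
    subst h
    rw [List.drop_of_length_le (by rw [length_nodeData]), accNodes_nil]
    simp [accDigits, packFZ]
  | succ t ih =>
    intro a0 h
    have ha : a0 < Z.length := by omega
    have hd1 : (nodeData cs Z φs).drop a0 = (nodeData cs Z φs).getD a0 ⟨[], 0⟩ :: (nodeData cs Z φs).drop (a0 + 1) := by
      rw [List.drop_eq_getElem_cons (by rw [length_nodeData]; exact ha), List.getD_eq_getElem _ _ (by rw [length_nodeData]; exact ha)]
    have hd2 : xys0.drop a0 = ((xys0.getD a0 (0, 0)).1, (xys0.getD a0 (0, 0)).2) :: xys0.drop (a0 + 1) := by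
      rw [List.drop_eq_getElem_cons (by omega), List.getD_eq_getElem _ _ (by omega)]
    rw [hd1, hd2, accNodes_cons, ih (a0 + 1) (by omega), nodeData_getD cs Z φs ha]
    simp only
    rw [innerSums_node cs Z φs xys0 hsq hφ hx ha]
    have hsplit : ∀ (f : ℕ → ℤ), ∑ a ∈ Ico a0 Z.length, f a = f a0 + ∑ a ∈ Ico (a0 + 1) Z.length, f a :=
      fun f => Finset.sum_eq_sum_Ico_succ_bot ha f
    have hnom : -2 * sumZ (Z.getD a0 []) * (((SCL * wPack cs (φs.getD a0 0) : ℕ) : ℤ)) =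
        packFZ cs.length (fun k => nodeW cs Z φs a0 k) := by
      push_cast
      rw [wPack_castZ, show -2 * sumZ (Z.getD a0 []) * ((SCL : ℕ) * packFZ cs.length fun k => (wAt cs (φs.getD a0 0) k : ℤ)) =
        (-2 * sumZ (Z.getD a0 []) * (SCL : ℕ)) * packFZ cs.length fun k => (wAt cs (φs.getD a0 0) k : ℤ) by ring, packFZ_smul]
      rfl
    simp only [accDigits]
    refine CellAcc.ext ?_ ?_ ?_ ?_ ?_ ?_ <;> simp only
    · rw [packFZ_smul, packFZ_add]; refine packFZ_congr fun k _ => ?_; rw [hsplit, Finset.mul_sum]; ring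
    · rw [packFZ_smul, packFZ_add]; refine packFZ_congr fun k _ => ?_; rw [hsplit, Finset.mul_sum]; ring
    · rw [packFZ_smul, packFZ_add]; refine packFZ_congr fun k _ => ?_; rw [hsplit, Finset.mul_sum]; ring
    · rw [packFZ_smul, packFZ_add]; refine packFZ_congr fun k _ => ?_; rw [hsplit, Finset.mul_sum]; ring
    · rw [hnom, mul_comm, packFZ_smul, packFZ_add]; refine packFZ_congr fun k _ => ?_; rw [hsplit]; ring
    · rw [hnom, mul_comm, packFZ_smul, packFZ_add]; refine packFZ_congr fun k _ => ?_; rw [hsplit]; ring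

end Summit.RiemannHypothesis.RiemannHypothesis.Theorems.IntegerScrew.Manifest.Fast
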